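import Summits.QuantumFields.BalabanUV.Beta.GAN24.WSlotT2DriftFromOne
import Summits.QuantumFields.BalabanUV.Beta.GAN24.ChargeStepSymD1
import Summits.QuantumFields.BalabanUV.Beta.GAN24.T2UnitSplitFrom
import Summits.QuantumFields.BalabanUV.Beta.GAN24.TransportMarginal
import Summits.QuantumFields.BalabanUV.Beta.GAN24.TransportIrrelevant
import Summits.QuantumFields.BalabanUV.Beta.MixedJetTablesPlug
import Summits.QuantumFields.BalabanUV.Beta.GAN24.W3SourceRowsBorder
import Summits.QuantumFields.BalabanUV.Beta.GAN24.StencilSlotSThree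
import Summits.QuantumFields.BalabanUV.Beta.GAN24.WSlotThree
import Summits.QuantumFields.BalabanUV.Beta.GAN24.T2SlotOfHW
import Summits.QuantumFields.BalabanUV.Beta.GAN24.T2SlotUnits
import Summits.QuantumFields.BalabanUV.Beta.GAN24.WSlotMixedShape
import Summits.QuantumFields.BalabanUV.Beta.GAN24.W3SourceRowsEnd
import Summits.QuantumFields.BalabanUV.Beta.GAN24.WSlotForcingZeroModeW3
import Summits.QuantumFields.BalabanUV.Beta.GAN24.WSlotFirstDiff
import Summits.QuantumFields.BalabanUV.Beta.GAN24.WSlotCauchyThree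

/-!
# `BalabanUV.Beta.GAN24.WSlotT2DriftFromOneThree` — binder row G-an2-4 / (CONV-C), W-slot road «W3» at `d = 3`, `Lc ≥ 2`, an1's mixed table
# `mixFFAt (toSite r) Lc`, base root: **END #2′ (the difference tower unrolled from `D♮₁`, re-cut (R1) of record) COMPOSED BY NAME WITH EVERY LANDED
# ROW — «T2Drift» AND THE D1 WALL'S W-PAIR `(hW₂, hW₂all)` FROM {ROW W3-F2a, THE EXACT PIN} ALONE, with NO `hZ0`** (ref2 r59 §A ∕ r61 §C–§D
# compositions re-run on `WSlotT2DriftFromOne.t2Drift_of_rows_from_one` + `ChargeStepSymD1.hZ1_three`)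

NOT IN PRINT; OUR BOOKKEEPING — [folklore] composition of TREE theorems by name, 0 concatenation (G-an2-4 formalisation swarm, leaf prover
`b2b-balaban-gan24-formalise-leaf-18`, gen 18; the composition pattern is referee ref2's `Ref2AxR59`∕`Ref2AxR61` probes, gen30∕gen31, re-typed
without `abbrev`s; module name PROVISIONAL — yields to the owner gan24-p1 successor ∕ END #3 `WSlotT2Tables`).  HONEST FRAMING (cell contract,
verbatim): «discharging `BetaPertH` makes Bałaban's UV stability UNCONDITIONAL — a real constructive-QFT result; it is NOT the continuum limit and
NOT the Clay problem.»  HONEST DEPENDENCY (verbatim): «continuum YM on T⁴ ⇐ BetaPertH ∧ nine spine estimates (0/9 proved); BetaPertH ⇐ (D1) ∧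
(D4) ∧ CAP+tail; G-an2-4 gates asym, D1 and NE2/3/4.»

WHAT (all at `d = 3`, `2 ≤ Lc`, `r ∈ box 4 Lc`, `T♮_j := unitS₂ (sfStep Lc j) (smStep 3 Lc j) (T2Of 3 Lc cE cVH cΛ cE₂ cB Tc (vh₂S 3 Lc) (mixFFAt (toSite r) Lc) j)`,
ROW W3-F2a `hZ : ∀ m, Zfree (b♮ m)` in ref2 R57-2 (b)'s conjunction currency — jointly `Lc`-covariant ∧ cell ff zero mode `= 0` — written inline):
* §1 `t2Shape_three_of_F2a_pin` — «T2Shape» ⇐ {F2a, `hpin : |cE₂| ≤ Lc^{2(3+1)}`}: END #1 `WSlotT2OfPieces.t2Shape_of_rows` with F1a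
  (`T2UnitSplitShapes.unitS₂_T2Of_eq_transport_add_sum_vh₂S_of_mix`), F3a (`TransportMarginal.hTmarg_three`), F3b (`TransportIrrelevant.hTirr_three`),
  F4a (`W3SourceRowsBorder.hb_border`), F4c (`T2SlotOfHW.locStencil₂_unitS₂_T2Of_zero`), K-slot `WSlotThree.unitDecayK_three`, «E3Shape»
  `StencilSlotSThree.e3Shape_three`, an1's `hmix_an1`∕`mixFFAt_hfm`∕`mixFFAt_hm` — referee ref2's r59 §A composition as a tree theorem;
* §2 **`t2Drift_three_of_F2a_pinEq`** — «T2Drift» (one-step ∧ Cauchy ∧ entrywise sup-rate, the conclusion text of END #2 ∕ END #2′) ⇐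
  {F2a, `hpinEq : cE₂ = +(Lc:ℝ)^(2*(3+1))`}: END #2′ `WSlotT2DriftFromOne.t2Drift_of_rows_from_one` with F1b′ := leaf-01's
  `T2UnitSplitFrom.unitS₂_T2Of_sub_eq_transport_add_sum_one_vh₂S_of_mix` (`P := fun m k ↦ transport 𝒜 (m+2) k`), F3b (`hTirr_three`, shifted by 2),
  F4b `W3SourceRowsEnd.hf_three` and F2b `WSlotForcingZeroModeW3.hZf_of_hZ_W3` UNCHANGED (condition (w12)), F4d′ := shape of `D♮₁` from §1's
  «T2Shape» (`WSlotForcingZeroMode.locStencil₂_sub`) ∧ `ChargeStepSymD1.hZ1_three_of_hZ` (the pin row, EXACT pin, any `Tc`), member `0` by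
  leaf-07's `WSlotFirstDiff.hD0_shape` — **NO `hZ0`**: by `ChargeStepSymD1.hZ1_iff_pinEq_w22` the hypothesis set {F2a, hpinEq} is exactly what
  `hZ1` costs at an3's `w22 N` (contrast END #2 from `D♮₀`, vacuous there: `WilsonQuarticChargeOffDiag.not_hZ0_of_hZb0_w22`, ref2 R61-2);
* §3 **`hW_hWall_three_of_F2a_pinEq`** — the D1 wall's W-PAIR (`hW₂` uniform ∧ `hW₂all` Cauchy) for an1's `WbalOf ∘ T2Of` ⇐ {F2a, hpinEq}, via r49's
  `WSlotCauchyThree.hW_hWall_three_of_T2ShapeDrift` (ref2 r61 §D's composition with END #2′ in place of END #2; parent socket unchanged).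
HONEST: COUNTDOWN compositions, NOT closures — ROW W3-F2a is OPEN (leaf-20 lineage), the EXACT pin `cE₂ = +Lc⁸` is UNDISCHARGED (an2's (P6); which
`Tc` the (D1) identification uses is an2∕an3's call), the window and the identification `hW′` are untouched; asserts NO shape of Bałaban's tables
beyond the named tree theorems; 0 `def`, 0 `def … : Prop`, 0 cite, 0 sorry; the W-pair here is for ONE family under an undischarged exact pin —
NOT «W-slot closed», NEVER «G-an2-4 closed», NOT (CONV-C); NOT BetaPertH, NOT continuum, NOT Clay.
-/

noncomputable section

open Finset
open scoped BigOperators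
open Literature.MathematicalPhysics.QuantumFieldTheory
open Literature.MathematicalPhysics.QuantumFieldTheory.Balaban1983to89
open Literature.MathematicalPhysics.QuantumFieldTheory.Balaban1983to89.Beta
open Literature.MathematicalPhysics.QuantumFieldTheory.Balaban1983to89.Beta.AffineAveraging (box toSite)
open Literature.MathematicalPhysics.QuantumFieldTheory.Balaban1983to89.Beta.AveragingMixedJetTables (mixFFAt mixFFAt_translate)
open ExpKernelCalculus (MKer shiftK VertexFamily₂)
open OneStepResolventKernel (Fib)
open OneStepKernelFamily (KInvStep)
open StepJetData (mfNeg)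
open BalabanCompositeJets (LocStencil₂)
open SecondOrderResponse (LocStencilFM W2SymOfK)
open BalabanStepJetsSucc (mmRead)
open BalabanStepW2 (K3OfK Spure M1 M2Of T2Of WbalOf)
open AveragingMixedJetTables (vh₂S)
open Summit.QuantumFields.BalabanUV.Beta.HessKerDressedUnits (unitK unitS unitW)
open Summit.QuantumFields.BalabanUV.Beta.SecondOrderUnits (unitM unitS₂ unitM₂)
open Summit.QuantumFields.BalabanUV.Beta.GAN24.CombesThomas (UnitDecayK sfStep smStep)
open Summit.QuantumFields.BalabanUV.Beta.GAN24.T2RecursionAffine (lin4)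
open Summit.QuantumFields.BalabanUV.Beta.GAN24.AffineUnroll (transport)
open Summit.QuantumFields.BalabanUV.Beta.GAN24.BiStencilZeroMode (zmode)
open Summit.QuantumFields.BalabanUV.Beta.GAN24.TransportMarginal (hTmarg_three)
open Summit.QuantumFields.BalabanUV.Beta.GAN24.TransportIrrelevant (hTirr_three)
open Summit.QuantumFields.BalabanUV.Beta.GAN24.WSlotT2OfPieces (t2Shape_of_rows)
open Summit.QuantumFields.BalabanUV.Beta.GAN24.WSlotT2DriftFromOne (t2Drift_of_rows_from_one)
open Summit.QuantumFields.BalabanUV.Beta.GAN24.T2UnitSplitShapes (unitS₂_T2Of_eq_transport_add_sum_vh₂S_of_mix)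
open Summit.QuantumFields.BalabanUV.Beta.GAN24.T2UnitSplitFrom (unitS₂_T2Of_sub_eq_transport_add_sum_one_vh₂S_of_mix)
open Summit.QuantumFields.BalabanUV.Beta.MixedJetTablesPlug (hmix_an1)
open Summit.QuantumFields.BalabanUV.Beta.GAN24.W3SourceRowsBorder (hb_border)
open Summit.QuantumFields.BalabanUV.Beta.GAN24.StencilSlotSThree (e3Shape_three)
open Summit.QuantumFields.BalabanUV.Beta.GAN24.WSlotThree (unitDecayK_three)
open Summit.QuantumFields.BalabanUV.Beta.GAN24.T2SlotOfHW (locStencil₂_unitS₂_T2Of_zero)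
open Summit.QuantumFields.BalabanUV.Beta.GAN24.T2SlotUnits (locStencil₂_vh₂S)
open Summit.QuantumFields.BalabanUV.Beta.GAN24.WSlotMixedShape (mixFFAt_hfm mixFFAt_hm)
open Summit.QuantumFields.BalabanUV.Beta.GAN24.W3SourceRowsEnd (hf_three)
open Summit.QuantumFields.BalabanUV.Beta.GAN24.WSlotForcingZeroMode (locStencil₂_sub)
open Summit.QuantumFields.BalabanUV.Beta.GAN24.WSlotForcingZeroModeW3 (hZf_of_hZ_W3)
open Summit.QuantumFields.BalabanUV.Beta.GAN24.WSlotFirstDiff (hD0_shape)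
open Summit.QuantumFields.BalabanUV.Beta.GAN24.WSlotCauchyThree (hW_hWall_three_of_T2ShapeDrift)
open Summit.QuantumFields.BalabanUV.Beta.GAN24.ChargeStepSymD1 (hZ1_three_of_hZ)

namespace Summit.QuantumFields.BalabanUV.Beta.GAN24.WSlotT2DriftFromOneThree

variable {Lc : ℕ} [NeZero Lc] {r : Fin 4 → ℕ}

/-! ## §1 «T2Shape» at d = 3 from ROW W3-F2a and the pin (referee ref2's r59 §A composition, by name) -/

/-- **«T2Shape» FOR an2's STAGE-B FAMILY AT `d = 3`, `Lc ≥ 2`, an1's `mixFFAt`, BASE ROOT, FROM ROW W3-F2a (record conjunction currency) AND THE PIN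
ALONE** [folklore composition; = referee ref2's probe `Ref2R57C.t2Shape_of_F2a_pin` (r59 §A) re-typed without abbreviations].  END #1
`WSlotT2OfPieces.t2Shape_of_rows` with `hsplit` := F1a, `hTmarg` := F3a, `hTirr` := F3b, `hb` := F4a (`hb_border` at `B := vh₂S 3 Lc`, rate `δb`),
`h0` := F4c, the K-slot (`unitDecayK_three`), «E3Shape» (`e3Shape_three`) and an1's mixed-table data — ALL TREE THEOREMS BY NAME; `Zfree` := the
conjunction currency inline, `mom := 0`, `ρ := Lc⁻¹`.  Residual binders: `hZ` (ROW W3-F2a) and `hpin`. -/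
theorem t2Shape_three_of_F2a_pin (hLc2 : 2 ≤ Lc) (hr : r ∈ box 4 Lc)
    (cE cVH cΛ cE₂ cB : ℝ) (Tc : Fin 4 → Fin 4 → Fin 4 → Fin 4 → ℝ)
    (hpin : |cE₂| ≤ (Lc : ℝ) ^ (2 * (3 + 1)))
    (hZ : ∀ m, (∀ (κ : Fin (3 + 1)) (u : Fin (3 + 1) → ℤ) (κ' : Fin (3 + 1)) (u' t : Fin (3 + 1) → ℤ),
        (fun κ u κ' u' => (cE₂ * (Lc : ℝ) ^ (2 * (3 + 1))) • mmRead Lc (K3OfK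
            (unitK (sfStep Lc m) (smStep 3 Lc m) (KInvStep (d := 3) Lc m)) Lc (unitS (sfStep Lc m) (smStep 3 Lc m) (Spure 3 Lc cE cVH cΛ m))
            (unitM (sfStep Lc m) (smStep 3 Lc m) (M1 3 Lc cΛ m)) (W2SymOfK (unitK (sfStep Lc m) (smStep 3 Lc m) (KInvStep (d := 3) Lc m)) Lc
            (unitS (sfStep Lc m) (smStep 3 Lc m) (Spure 3 Lc cE cVH cΛ m)) (unitM (sfStep Lc m) (smStep 3 Lc m) (M1 3 Lc cΛ m)) 0
            (unitM₂ (sfStep Lc m) (smStep 3 Lc m) (M2Of 3 Lc (mixFFAt (toSite r) Lc) m))) κ u κ' u') + cB • mfNeg ((vh₂S 3 Lc) κ u κ' u')) κ (u + (Lc : ℤ) • t) κ' (u' + (Lc : ℤ) • t)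
          = shiftK (-((Lc : ℤ) • t)) ((fun κ u κ' u' => (cE₂ * (Lc : ℝ) ^ (2 * (3 + 1))) • mmRead Lc (K3OfK
            (unitK (sfStep Lc m) (smStep 3 Lc m) (KInvStep (d := 3) Lc m)) Lc (unitS (sfStep Lc m) (smStep 3 Lc m) (Spure 3 Lc cE cVH cΛ m))
            (unitM (sfStep Lc m) (smStep 3 Lc m) (M1 3 Lc cΛ m)) (W2SymOfK (unitK (sfStep Lc m) (smStep 3 Lc m) (KInvStep (d := 3) Lc m)) Lc
            (unitS (sfStep Lc m) (smStep 3 Lc m) (Spure 3 Lc cE cVH cΛ m)) (unitM (sfStep Lc m) (smStep 3 Lc m) (M1 3 Lc cΛ m)) 0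
            (unitM₂ (sfStep Lc m) (smStep 3 Lc m) (M2Of 3 Lc (mixFFAt (toSite r) Lc) m))) κ u κ' u') + cB • mfNeg ((vh₂S 3 Lc) κ u κ' u')) κ u κ' u')) ∧
      (∀ (κ κ' α β : Fin (3 + 1)), zmode Lc (fun κ u κ' u' => (cE₂ * (Lc : ℝ) ^ (2 * (3 + 1))) • mmRead Lc (K3OfK
            (unitK (sfStep Lc m) (smStep 3 Lc m) (KInvStep (d := 3) Lc m)) Lc (unitS (sfStep Lc m) (smStep 3 Lc m) (Spure 3 Lc cE cVH cΛ m))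
            (unitM (sfStep Lc m) (smStep 3 Lc m) (M1 3 Lc cΛ m)) (W2SymOfK (unitK (sfStep Lc m) (smStep 3 Lc m) (KInvStep (d := 3) Lc m)) Lc
            (unitS (sfStep Lc m) (smStep 3 Lc m) (Spure 3 Lc cE cVH cΛ m)) (unitM (sfStep Lc m) (smStep 3 Lc m) (M1 3 Lc cΛ m)) 0
            (unitM₂ (sfStep Lc m) (smStep 3 Lc m) (M2Of 3 Lc (mixFFAt (toSite r) Lc) m))) κ u κ' u') + cB • mfNeg ((vh₂S 3 Lc) κ u κ' u')) κ κ' (Sum.inl α) (Sum.inl β) = 0)) :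
    ∃ C₂ δ₂ : ℝ, 0 < δ₂ ∧ ∀ j, LocStencil₂ (unitS₂ (sfStep Lc j) (smStep 3 Lc j) (T2Of 3 Lc cE cVH cΛ cE₂ cB Tc (vh₂S 3 Lc) (mixFFAt (toSite r) Lc) j)) C₂ δ₂ := by
  have hLc : 1 ≤ Lc := le_trans (by norm_num) hLc2
  obtain ⟨CK, mK, hmK, hK⟩ := unitDecayK_three (Lc := Lc) hLc2
  obtain ⟨C₃, δ₃, hδ₃, hE3⟩ := e3Shape_three (Lc := Lc) hLc2 cE cVH cΛ
  obtain ⟨CM₂, δ₄, hδ₄, hmixL⟩ := hmix_an1 (d := 3) (Lc := Lc) hLc hr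
  have hmixE : ∃ C δ : ℝ, 0 < δ ∧ LocStencilFM Lc (mixFFAt (toSite r) Lc) C δ := ⟨CM₂, δ₄, hδ₄, hmixL⟩
  obtain ⟨Cb, δb, hCb, hδb, hball⟩ := hb_border (d := 3) (Lc := Lc) hLc hK hmK hE3 hδ₃ hmixL hδ₄
    (mixFFAt_hfm (toSite r)) (mixFFAt_hm (toSite r))
    ⟨_, 1, one_pos, locStencil₂_vh₂S (d := 3) hLc zero_le_one⟩ cE₂ cB
  obtain ⟨CT, δT, hCT, hδT, hδTin, hTm⟩ := hTmarg_three hLc hK hmK cE₂ hδb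
  obtain ⟨CT', δT', hCT', hδT', hδT'in, hTi⟩ := hTirr_three hLc hK hmK cE₂ hδb
  have hρ0 : (0 : ℝ) ≤ (Lc : ℝ)⁻¹ := inv_nonneg.mpr (Nat.cast_nonneg _)
  have hρ1 : (Lc : ℝ)⁻¹ < 1 := by
    have : (1 : ℝ) < Lc := by exact_mod_cast (lt_of_lt_of_le (by norm_num) hLc2)
    exact inv_lt_one_of_one_lt₀ this
  refine t2Shape_of_rows (Lc := Lc) cE cVH cΛ cE₂ cB Tc (mixFFAt (toSite r) Lc)
    (fun m => (fun κ u κ' u' => (cE₂ * (Lc : ℝ) ^ (2 * (3 + 1))) • mmRead Lc (K3OfK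
            (unitK (sfStep Lc m) (smStep 3 Lc m) (KInvStep (d := 3) Lc m)) Lc (unitS (sfStep Lc m) (smStep 3 Lc m) (Spure 3 Lc cE cVH cΛ m))
            (unitM (sfStep Lc m) (smStep 3 Lc m) (M1 3 Lc cΛ m)) (W2SymOfK (unitK (sfStep Lc m) (smStep 3 Lc m) (KInvStep (d := 3) Lc m)) Lc
            (unitS (sfStep Lc m) (smStep 3 Lc m) (Spure 3 Lc cE cVH cΛ m)) (unitM (sfStep Lc m) (smStep 3 Lc m) (M1 3 Lc cΛ m)) 0
            (unitM₂ (sfStep Lc m) (smStep 3 Lc m) (M2Of 3 Lc (mixFFAt (toSite r) Lc) m))) κ u κ' u') + cB • mfNeg ((vh₂S 3 Lc) κ u κ' u')))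
    (fun m k => transport (fun j => lin4 (cE₂ * (Lc : ℝ) ^ (2 * (3 + 1))) (unitK (sfStep Lc j) (smStep 3 Lc j) (KInvStep (d := 3) Lc j)) Lc) m k)
    (fun X : Fin (3 + 1) → (Fin (3 + 1) → ℤ) → Fin (3 + 1) → (Fin (3 + 1) → ℤ) → MKer (3 + 1) (Fib 3) =>
      (∀ (κ : Fin (3 + 1)) (u : Fin (3 + 1) → ℤ) (κ' : Fin (3 + 1)) (u' t : Fin (3 + 1) → ℤ), X κ (u + (Lc : ℤ) • t) κ' (u' + (Lc : ℤ) • t) = shiftK (-((Lc : ℤ) • t)) (X κ u κ' u')) ∧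
        ∀ (κ κ' κ₁ κ₂ : Fin (3 + 1)), zmode Lc X κ κ' (Sum.inl κ₁) (Sum.inl κ₂) = 0)
    (fun _ => 0)
    (δin := δb) (δT := min δT δT') (CT := CT) (CT' := CT') (ρ := (Lc : ℝ)⁻¹) (Cb := Cb)
    (lt_min hδT hδT') hCT' hρ0 hρ1 hpin
    (unitS₂_T2Of_eq_transport_add_sum_vh₂S_of_mix (d := 3) (cE := cE) (cVH := cVH) (cΛ := cΛ) (cE₂ := cE₂) (cB := cB) (Tc := Tc)
      (mixFF := mixFFAt (toSite r) Lc) hLc hmixE)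
    (fun hp m k X C hC hX => (hTm hp m k X C hC hX).mono (min_le_left _ _))
    (fun m k X C hC hX hZX _ => (hTi hpin m k X C hC hX hZX.1 hZX.2).mono (min_le_right _ _))
    (fun m => ⟨(hball le_rfl m).1, hCb⟩) hZ
    (locStencil₂_unitS₂_T2Of_zero (d := 3) hLc cE cVH cΛ cE₂ cB Tc (mixFFAt (toSite r) Lc) hδb.le)

/-! ## §2 «T2Drift» at d = 3 from ROW W3-F2a and the EXACT pin — END #2′ (unrolled from `D♮₁`), NO `hZ0` -/

/-- **«T2Drift» (ONE-STEP ∧ CAUCHY ∧ ENTRYWISE SUP-RATE) FOR an2's STAGE-B FAMILY AT `d = 3`, `Lc ≥ 2`, an1's `mixFFAt`, BASE ROOT, FROM ROW W3-F2a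
AND THE EXACT PIN ALONE** [folklore composition].  END #2′ `WSlotT2DriftFromOne.t2Drift_of_rows_from_one` (difference tower unrolled from `D♮₁`,
re-cut (R1) of record, ref2 R61-2 (b)) with: `hsplit` := F1b′ = leaf-01's `T2UnitSplitFrom.unitS₂_T2Of_sub_eq_transport_add_sum_one_vh₂S_of_mix`
(`P := fun m k ↦ transport 𝒜 (m+2) k`); `hTirr` := F3b `TransportIrrelevant.hTirr_three` at levels `m + 2`; `hf` := F4b `W3SourceRowsEnd.hf_three`
(at `hx` := §1's «T2Shape») and `hZf` := F2b `WSlotForcingZeroModeW3.hZf_of_hZ_W3` — BOTH RE-PLUGGED UNCHANGED (condition (w12)); `h1` := shape of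
`D♮₁ = T♮₂ − T♮₁` from §1 (`locStencil₂_sub`); `hZ1` := `ChargeStepSymD1.hZ1_three_of_hZ` (ROW W3-F4d′: EXACT pin `cE₂ = +Lc^{2(3+1)}`, ANY `Tc`);
`h00` := leaf-07's `WSlotFirstDiff.hD0_shape`; `δin := min δf (min δ₀ δ₂)`.  Residual binders: **`hZ` (ROW W3-F2a) and `hpinEq`** — NO `hZ0`
(`WilsonQuarticChargeOffDiag.not_hZ0_of_hZb0_w22`: with `hZ0` the residual was vacuous at `w22 N`; here, by `ChargeStepSymD1.hZ1_iff_pinEq_w22`,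
`hZ1` costs exactly the pin). -/
theorem t2Drift_three_of_F2a_pinEq (hLc2 : 2 ≤ Lc) (hr : r ∈ box 4 Lc)
    (cE cVH cΛ cE₂ cB : ℝ) (Tc : Fin 4 → Fin 4 → Fin 4 → Fin 4 → ℝ)
    (hpinEq : cE₂ = (Lc : ℝ) ^ (2 * (3 + 1)))
    (hZ : ∀ m, (∀ (κ : Fin (3 + 1)) (u : Fin (3 + 1) → ℤ) (κ' : Fin (3 + 1)) (u' t : Fin (3 + 1) → ℤ),
        (fun κ u κ' u' => (cE₂ * (Lc : ℝ) ^ (2 * (3 + 1))) • mmRead Lc (K3OfK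
            (unitK (sfStep Lc m) (smStep 3 Lc m) (KInvStep (d := 3) Lc m)) Lc (unitS (sfStep Lc m) (smStep 3 Lc m) (Spure 3 Lc cE cVH cΛ m))
            (unitM (sfStep Lc m) (smStep 3 Lc m) (M1 3 Lc cΛ m)) (W2SymOfK (unitK (sfStep Lc m) (smStep 3 Lc m) (KInvStep (d := 3) Lc m)) Lc
            (unitS (sfStep Lc m) (smStep 3 Lc m) (Spure 3 Lc cE cVH cΛ m)) (unitM (sfStep Lc m) (smStep 3 Lc m) (M1 3 Lc cΛ m)) 0
            (unitM₂ (sfStep Lc m) (smStep 3 Lc m) (M2Of 3 Lc (mixFFAt (toSite r) Lc) m))) κ u κ' u') + cB • mfNeg ((vh₂S 3 Lc) κ u κ' u')) κ (u + (Lc : ℤ) • t) κ' (u' + (Lc : ℤ) • t)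
          = shiftK (-((Lc : ℤ) • t)) ((fun κ u κ' u' => (cE₂ * (Lc : ℝ) ^ (2 * (3 + 1))) • mmRead Lc (K3OfK
            (unitK (sfStep Lc m) (smStep 3 Lc m) (KInvStep (d := 3) Lc m)) Lc (unitS (sfStep Lc m) (smStep 3 Lc m) (Spure 3 Lc cE cVH cΛ m))
            (unitM (sfStep Lc m) (smStep 3 Lc m) (M1 3 Lc cΛ m)) (W2SymOfK (unitK (sfStep Lc m) (smStep 3 Lc m) (KInvStep (d := 3) Lc m)) Lc
            (unitS (sfStep Lc m) (smStep 3 Lc m) (Spure 3 Lc cE cVH cΛ m)) (unitM (sfStep Lc m) (smStep 3 Lc m) (M1 3 Lc cΛ m)) 0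
            (unitM₂ (sfStep Lc m) (smStep 3 Lc m) (M2Of 3 Lc (mixFFAt (toSite r) Lc) m))) κ u κ' u') + cB • mfNeg ((vh₂S 3 Lc) κ u κ' u')) κ u κ' u')) ∧
      (∀ (κ κ' α β : Fin (3 + 1)), zmode Lc (fun κ u κ' u' => (cE₂ * (Lc : ℝ) ^ (2 * (3 + 1))) • mmRead Lc (K3OfK
            (unitK (sfStep Lc m) (smStep 3 Lc m) (KInvStep (d := 3) Lc m)) Lc (unitS (sfStep Lc m) (smStep 3 Lc m) (Spure 3 Lc cE cVH cΛ m))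
            (unitM (sfStep Lc m) (smStep 3 Lc m) (M1 3 Lc cΛ m)) (W2SymOfK (unitK (sfStep Lc m) (smStep 3 Lc m) (KInvStep (d := 3) Lc m)) Lc
            (unitS (sfStep Lc m) (smStep 3 Lc m) (Spure 3 Lc cE cVH cΛ m)) (unitM (sfStep Lc m) (smStep 3 Lc m) (M1 3 Lc cΛ m)) 0
            (unitM₂ (sfStep Lc m) (smStep 3 Lc m) (M2Of 3 Lc (mixFFAt (toSite r) Lc) m))) κ u κ' u') + cB • mfNeg ((vh₂S 3 Lc) κ u κ' u')) κ κ' (Sum.inl α) (Sum.inl β) = 0)) :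
    ∃ c ϑ δT : ℝ, 0 ≤ c ∧ 0 < ϑ ∧ ϑ < 1 ∧ 0 < δT ∧
      (∀ n, LocStencil₂ (fun κ u κ' u' => unitS₂ (sfStep Lc (n + 1)) (smStep 3 Lc (n + 1)) (T2Of 3 Lc cE cVH cΛ cE₂ cB Tc (vh₂S 3 Lc) (mixFFAt (toSite r) Lc) (n + 1)) κ u κ' u' - unitS₂ (sfStep Lc n) (smStep 3 Lc n) (T2Of 3 Lc cE cVH cΛ cE₂ cB Tc (vh₂S 3 Lc) (mixFFAt (toSite r) Lc) n) κ u κ' u') (c * ϑ ^ n) δT) ∧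
      (∀ k j, LocStencil₂ (fun κ u κ' u' => unitS₂ (sfStep Lc (k + j)) (smStep 3 Lc (k + j)) (T2Of 3 Lc cE cVH cΛ cE₂ cB Tc (vh₂S 3 Lc) (mixFFAt (toSite r) Lc) (k + j)) κ u κ' u' - unitS₂ (sfStep Lc k) (smStep 3 Lc k) (T2Of 3 Lc cE cVH cΛ cE₂ cB Tc (vh₂S 3 Lc) (mixFFAt (toSite r) Lc) k) κ u κ' u') (c * (1 - ϑ)⁻¹ * ϑ ^ k) δT) ∧
      (∀ n κ u κ' u' x z a b, |unitS₂ (sfStep Lc (n + 1)) (smStep 3 Lc (n + 1)) (T2Of 3 Lc cE cVH cΛ cE₂ cB Tc (vh₂S 3 Lc) (mixFFAt (toSite r) Lc) (n + 1)) κ u κ' u' x z a b - unitS₂ (sfStep Lc n) (smStep 3 Lc n) (T2Of 3 Lc cE cVH cΛ cE₂ cB Tc (vh₂S 3 Lc) (mixFFAt (toSite r) Lc) n) κ u κ' u' x z a b| ≤ c * ϑ ^ n) := by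
  have hLc : 1 ≤ Lc := le_trans (by norm_num) hLc2
  have hpin : |cE₂| ≤ (Lc : ℝ) ^ (2 * (3 + 1)) := by
    rw [hpinEq, abs_of_nonneg (by positivity)]
  obtain ⟨CK, mK, hmK, hK⟩ := unitDecayK_three (Lc := Lc) hLc2
  obtain ⟨C₃, δ₃, hδ₃, hE3⟩ := e3Shape_three (Lc := Lc) hLc2 cE cVH cΛ
  obtain ⟨CM₂, δ₄, hδ₄, hmixL⟩ := hmix_an1 (d := 3) (Lc := Lc) hLc hr
  have hmixE : ∃ C δ : ℝ, 0 < δ ∧ LocStencilFM Lc (mixFFAt (toSite r) Lc) C δ := ⟨CM₂, δ₄, hδ₄, hmixL⟩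
  have hmixt := mixFFAt_translate (toSite r) Lc
  -- «T2Shape» (§1) = END #1's output: the `hx` of F4b and the shapes of members 1, 2
  obtain ⟨C₂, δ₂, hδ₂, hx⟩ := t2Shape_three_of_F2a_pin hLc2 hr cE cVH cΛ cE₂ cB Tc hpin hZ
  -- F4b at the tower shape (∀ m, every input rate ≤ δf)
  obtain ⟨Cf, θ, δf, hCf, hθ0, hθ1, hδf, hfall⟩ := hf_three (Lc := Lc) hLc2 cE cVH cΛ cE₂ cB hmixL hδ₄
    (mixFFAt_hfm (toSite r)) (mixFFAt_hm (toSite r)) (x := fun j => unitS₂ (sfStep Lc j) (smStep 3 Lc j) (T2Of 3 Lc cE cVH cΛ cE₂ cB Tc (vh₂S 3 Lc) (mixFFAt (toSite r) Lc) j)) hx hδ₂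
  -- member 0 of the difference tower: shape only (leaf-07)
  obtain ⟨C₀, δ₀, hδ₀, hC₀, hD0⟩ := hD0_shape (d := 3) (Lc := Lc) hLc cE cVH cΛ cE₂ cB Tc hmixE
  -- F4a (rate δb) for F2b's `hb`
  obtain ⟨Cb, δb, hCb, hδb, hball⟩ := hb_border (d := 3) (Lc := Lc) hLc hK hmK hE3 hδ₃ hmixL hδ₄
    (mixFFAt_hfm (toSite r)) (mixFFAt_hm (toSite r))
    ⟨_, 1, one_pos, locStencil₂_vh₂S (d := 3) hLc zero_le_one⟩ cE₂ cB
  -- F2b from F2a (UNCHANGED ∀ m text)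
  have hZf : ∀ m, (fun X : Fin (3 + 1) → (Fin (3 + 1) → ℤ) → Fin (3 + 1) → (Fin (3 + 1) → ℤ) → MKer (3 + 1) (Fib 3) =>
      (∀ (κ : Fin (3 + 1)) (u : Fin (3 + 1) → ℤ) (κ' : Fin (3 + 1)) (u' t : Fin (3 + 1) → ℤ), X κ (u + (Lc : ℤ) • t) κ' (u' + (Lc : ℤ) • t) = shiftK (-((Lc : ℤ) • t)) (X κ u κ' u')) ∧
        ∀ (κ κ' κ₁ κ₂ : Fin (3 + 1)), zmode Lc X κ κ' (Sum.inl κ₁) (Sum.inl κ₂) = 0) (((lin4 (cE₂ * (Lc : ℝ) ^ (2 * (3 + 1))) (unitK (sfStep Lc (m + 1)) (smStep 3 Lc (m + 1)) (KInvStep (d := 3) Lc (m + 1))) Lc (unitS₂ (sfStep Lc m) (smStep 3 Lc m) (T2Of 3 Lc cE cVH cΛ cE₂ cB Tc (vh₂S 3 Lc) (mixFFAt (toSite r) Lc) m))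
          - lin4 (cE₂ * (Lc : ℝ) ^ (2 * (3 + 1))) (unitK (sfStep Lc m) (smStep 3 Lc m) (KInvStep (d := 3) Lc m)) Lc (unitS₂ (sfStep Lc m) (smStep 3 Lc m) (T2Of 3 Lc cE cVH cΛ cE₂ cB Tc (vh₂S 3 Lc) (mixFFAt (toSite r) Lc) m)))
        + ((fun κ u κ' u' => (cE₂ * (Lc : ℝ) ^ (2 * (3 + 1))) • mmRead Lc (K3OfK
            (unitK (sfStep Lc (m + 1)) (smStep 3 Lc (m + 1)) (KInvStep (d := 3) Lc (m + 1))) Lc (unitS (sfStep Lc (m + 1)) (smStep 3 Lc (m + 1)) (Spure 3 Lc cE cVH cΛ (m + 1)))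
            (unitM (sfStep Lc (m + 1)) (smStep 3 Lc (m + 1)) (M1 3 Lc cΛ (m + 1))) (W2SymOfK (unitK (sfStep Lc (m + 1)) (smStep 3 Lc (m + 1)) (KInvStep (d := 3) Lc (m + 1))) Lc
            (unitS (sfStep Lc (m + 1)) (smStep 3 Lc (m + 1)) (Spure 3 Lc cE cVH cΛ (m + 1))) (unitM (sfStep Lc (m + 1)) (smStep 3 Lc (m + 1)) (M1 3 Lc cΛ (m + 1))) 0
            (unitM₂ (sfStep Lc (m + 1)) (smStep 3 Lc (m + 1)) (M2Of 3 Lc (mixFFAt (toSite r) Lc) (m + 1)))) κ u κ' u') + cB • mfNeg ((vh₂S 3 Lc) κ u κ' u'))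
          - (fun κ u κ' u' => (cE₂ * (Lc : ℝ) ^ (2 * (3 + 1))) • mmRead Lc (K3OfK
            (unitK (sfStep Lc m) (smStep 3 Lc m) (KInvStep (d := 3) Lc m)) Lc (unitS (sfStep Lc m) (smStep 3 Lc m) (Spure 3 Lc cE cVH cΛ m))
            (unitM (sfStep Lc m) (smStep 3 Lc m) (M1 3 Lc cΛ m)) (W2SymOfK (unitK (sfStep Lc m) (smStep 3 Lc m) (KInvStep (d := 3) Lc m)) Lc
            (unitS (sfStep Lc m) (smStep 3 Lc m) (Spure 3 Lc cE cVH cΛ m)) (unitM (sfStep Lc m) (smStep 3 Lc m) (M1 3 Lc cΛ m)) 0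
            (unitM₂ (sfStep Lc m) (smStep 3 Lc m) (M2Of 3 Lc (mixFFAt (toSite r) Lc) m))) κ u κ' u') + cB • mfNeg ((vh₂S 3 Lc) κ u κ' u'))))) := fun m =>
    hZf_of_hZ_W3 (d := 3) (Lc := Lc) hLc cE cVH cΛ cE₂ cB Tc hmixE hmixt hδb (fun m => (hball le_rfl m).1) hZ m
  -- the input rate
  set δin := min δf (min δ₀ δ₂) with hδin_def
  have hδin : 0 < δin := lt_min hδf (lt_min hδ₀ hδ₂)
  -- F3b at δin, transport from levels m + 2
  obtain ⟨CT', δT', hCT', hδT', hδT'in, hTi⟩ := hTirr_three hLc hK hmK cE₂ hδin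
  have hρ0 : (0 : ℝ) ≤ (Lc : ℝ)⁻¹ := inv_nonneg.mpr (Nat.cast_nonneg _)
  have hρ1 : (Lc : ℝ)⁻¹ < 1 := by
    have : (1 : ℝ) < Lc := by exact_mod_cast (lt_of_lt_of_le (by norm_num) hLc2)
    exact inv_lt_one_of_one_lt₀ this
  -- F4d′: shape of `D♮₁ = T♮₂ − T♮₁` from «T2Shape», `Zfree` by the exact pin
  have hC₂ : 0 ≤ C₂ := (hx 0).nonneg
  have h1 : LocStencil₂ (fun κ u κ' u' => unitS₂ (sfStep Lc 2) (smStep 3 Lc 2) (T2Of 3 Lc cE cVH cΛ cE₂ cB Tc (vh₂S 3 Lc) (mixFFAt (toSite r) Lc) 2) κ u κ' u' - unitS₂ (sfStep Lc 1) (smStep 3 Lc 1) (T2Of 3 Lc cE cVH cΛ cE₂ cB Tc (vh₂S 3 Lc) (mixFFAt (toSite r) Lc) 1) κ u κ' u') (C₂ + |(-1 : ℝ)| * C₂) δin :=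
    (locStencil₂_sub (hx 2) (hx 1)).mono (le_trans (min_le_right _ _) (min_le_right _ _))
  have hZ1 : (fun X : Fin (3 + 1) → (Fin (3 + 1) → ℤ) → Fin (3 + 1) → (Fin (3 + 1) → ℤ) → MKer (3 + 1) (Fib 3) =>
      (∀ (κ : Fin (3 + 1)) (u : Fin (3 + 1) → ℤ) (κ' : Fin (3 + 1)) (u' t : Fin (3 + 1) → ℤ), X κ (u + (Lc : ℤ) • t) κ' (u' + (Lc : ℤ) • t) = shiftK (-((Lc : ℤ) • t)) (X κ u κ' u')) ∧
        ∀ (κ κ' κ₁ κ₂ : Fin (3 + 1)), zmode Lc X κ κ' (Sum.inl κ₁) (Sum.inl κ₂) = 0) (fun κ u κ' u' => unitS₂ (sfStep Lc 2) (smStep 3 Lc 2) (T2Of 3 Lc cE cVH cΛ cE₂ cB Tc (vh₂S 3 Lc) (mixFFAt (toSite r) Lc) 2) κ u κ' u' - unitS₂ (sfStep Lc 1) (smStep 3 Lc 1) (T2Of 3 Lc cE cVH cΛ cE₂ cB Tc (vh₂S 3 Lc) (mixFFAt (toSite r) Lc) 1) κ u κ' u') :=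
    hZ1_three_of_hZ hLc cE cVH cΛ cE₂ cB Tc hmixE hmixt hpinEq hZ
  obtain ⟨c, ϑ, hc, hϑ0, hϑ1, hD, hCau, hSup⟩ := t2Drift_of_rows_from_one (Lc := Lc) cE cVH cΛ cE₂ cB Tc (mixFFAt (toSite r) Lc)
    (fun i => ((lin4 (cE₂ * (Lc : ℝ) ^ (2 * (3 + 1))) (unitK (sfStep Lc (i + 1)) (smStep 3 Lc (i + 1)) (KInvStep (d := 3) Lc (i + 1))) Lc (unitS₂ (sfStep Lc i) (smStep 3 Lc i) (T2Of 3 Lc cE cVH cΛ cE₂ cB Tc (vh₂S 3 Lc) (mixFFAt (toSite r) Lc) i))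
          - lin4 (cE₂ * (Lc : ℝ) ^ (2 * (3 + 1))) (unitK (sfStep Lc i) (smStep 3 Lc i) (KInvStep (d := 3) Lc i)) Lc (unitS₂ (sfStep Lc i) (smStep 3 Lc i) (T2Of 3 Lc cE cVH cΛ cE₂ cB Tc (vh₂S 3 Lc) (mixFFAt (toSite r) Lc) i)))
        + ((fun κ u κ' u' => (cE₂ * (Lc : ℝ) ^ (2 * (3 + 1))) • mmRead Lc (K3OfK
            (unitK (sfStep Lc (i + 1)) (smStep 3 Lc (i + 1)) (KInvStep (d := 3) Lc (i + 1))) Lc (unitS (sfStep Lc (i + 1)) (smStep 3 Lc (i + 1)) (Spure 3 Lc cE cVH cΛ (i + 1)))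
            (unitM (sfStep Lc (i + 1)) (smStep 3 Lc (i + 1)) (M1 3 Lc cΛ (i + 1))) (W2SymOfK (unitK (sfStep Lc (i + 1)) (smStep 3 Lc (i + 1)) (KInvStep (d := 3) Lc (i + 1))) Lc
            (unitS (sfStep Lc (i + 1)) (smStep 3 Lc (i + 1)) (Spure 3 Lc cE cVH cΛ (i + 1))) (unitM (sfStep Lc (i + 1)) (smStep 3 Lc (i + 1)) (M1 3 Lc cΛ (i + 1))) 0
            (unitM₂ (sfStep Lc (i + 1)) (smStep 3 Lc (i + 1)) (M2Of 3 Lc (mixFFAt (toSite r) Lc) (i + 1)))) κ u κ' u') + cB • mfNeg ((vh₂S 3 Lc) κ u κ' u'))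
          - (fun κ u κ' u' => (cE₂ * (Lc : ℝ) ^ (2 * (3 + 1))) • mmRead Lc (K3OfK
            (unitK (sfStep Lc i) (smStep 3 Lc i) (KInvStep (d := 3) Lc i)) Lc (unitS (sfStep Lc i) (smStep 3 Lc i) (Spure 3 Lc cE cVH cΛ i))
            (unitM (sfStep Lc i) (smStep 3 Lc i) (M1 3 Lc cΛ i)) (W2SymOfK (unitK (sfStep Lc i) (smStep 3 Lc i) (KInvStep (d := 3) Lc i)) Lc
            (unitS (sfStep Lc i) (smStep 3 Lc i) (Spure 3 Lc cE cVH cΛ i)) (unitM (sfStep Lc i) (smStep 3 Lc i) (M1 3 Lc cΛ i)) 0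
            (unitM₂ (sfStep Lc i) (smStep 3 Lc i) (M2Of 3 Lc (mixFFAt (toSite r) Lc) i))) κ u κ' u') + cB • mfNeg ((vh₂S 3 Lc) κ u κ' u')))))
    (fun m k => transport (fun j => lin4 (cE₂ * (Lc : ℝ) ^ (2 * (3 + 1))) (unitK (sfStep Lc j) (smStep 3 Lc j) (KInvStep (d := 3) Lc j)) Lc) (m + 2) k)
    (fun X : Fin (3 + 1) → (Fin (3 + 1) → ℤ) → Fin (3 + 1) → (Fin (3 + 1) → ℤ) → MKer (3 + 1) (Fib 3) =>
      (∀ (κ : Fin (3 + 1)) (u : Fin (3 + 1) → ℤ) (κ' : Fin (3 + 1)) (u' t : Fin (3 + 1) → ℤ), X κ (u + (Lc : ℤ) • t) κ' (u' + (Lc : ℤ) • t) = shiftK (-((Lc : ℤ) • t)) (X κ u κ' u')) ∧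
        ∀ (κ κ' κ₁ κ₂ : Fin (3 + 1)), zmode Lc X κ κ' (Sum.inl κ₁) (Sum.inl κ₂) = 0)
    (fun _ => 0)
    (δin := δin) (δT := δT') (CT' := CT') (ρ := (Lc : ℝ)⁻¹) (θ := θ) (Cf := Cf) (C₁ := C₂ + |(-1 : ℝ)| * C₂) (C₀₀ := C₀)
    hδT' hCT' hρ0 hρ1 hθ0 hθ1
    (unitS₂_T2Of_sub_eq_transport_add_sum_one_vh₂S_of_mix (d := 3) cE cVH cΛ cE₂ cB Tc (mixFFAt (toSite r) Lc) hLc hmixE)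
    (fun m k X C hC hX hZX _ => hTi hpin (m + 2) k X C hC hX hZX.1 hZX.2)
    (fun m => ⟨(hfall (min_le_left _ _) m).1, mul_nonneg hCf (pow_nonneg hθ0 m)⟩) hZf
    ⟨h1, add_nonneg hC₂ (mul_nonneg (abs_nonneg _) hC₂)⟩ hZ1
    ((hD0 δT' (le_trans hδT'in (le_trans (min_le_right _ _) (min_le_left _ _)))))
  exact ⟨c, ϑ, δT', hc, hϑ0, hϑ1, hδT', hD, hCau, hSup⟩

/-! ## §3 The D1 wall's W-PAIR for an1's `WbalOf ∘ T2Of` from ROW W3-F2a and the EXACT pin -/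

/-- **THE D1 WALL'S W-PAIR `(hW₂, hW₂all)` FOR an1's `WbalOf ∘ T2Of` AT `d = 3`, `Lc ≥ 2`, BASE ROOT, FROM {ROW W3-F2a, THE EXACT PIN} ALONE**
[folklore composition; referee ref2's r61 §D pattern with END #2′ in place of END #2]: §1 «T2Shape» + §2 Cauchy form, harmonised to one rate by
`LocStencil₂.mono`, plugged into r49's `WSlotCauchyThree.hW_hWall_three_of_T2ShapeDrift` — the parent socket UNCHANGED (ref2 R61-2 (b)).  COUNTDOWN
composition, NOT a closure: ROW W3-F2a and the exact pin `cE₂ = +Lc⁸` are OPEN; window and identification untouched. -/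
theorem hW_hWall_three_of_F2a_pinEq (hLc2 : 2 ≤ Lc) (hr : r ∈ box 4 Lc)
    (cE cVH cΛ cE₂ cB : ℝ) (Tc : Fin 4 → Fin 4 → Fin 4 → Fin 4 → ℝ)
    (hpinEq : cE₂ = (Lc : ℝ) ^ (2 * (3 + 1)))
    (hZ : ∀ m, (∀ (κ : Fin (3 + 1)) (u : Fin (3 + 1) → ℤ) (κ' : Fin (3 + 1)) (u' t : Fin (3 + 1) → ℤ),
        (fun κ u κ' u' => (cE₂ * (Lc : ℝ) ^ (2 * (3 + 1))) • mmRead Lc (K3OfK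
            (unitK (sfStep Lc m) (smStep 3 Lc m) (KInvStep (d := 3) Lc m)) Lc (unitS (sfStep Lc m) (smStep 3 Lc m) (Spure 3 Lc cE cVH cΛ m))
            (unitM (sfStep Lc m) (smStep 3 Lc m) (M1 3 Lc cΛ m)) (W2SymOfK (unitK (sfStep Lc m) (smStep 3 Lc m) (KInvStep (d := 3) Lc m)) Lc
            (unitS (sfStep Lc m) (smStep 3 Lc m) (Spure 3 Lc cE cVH cΛ m)) (unitM (sfStep Lc m) (smStep 3 Lc m) (M1 3 Lc cΛ m)) 0
            (unitM₂ (sfStep Lc m) (smStep 3 Lc m) (M2Of 3 Lc (mixFFAt (toSite r) Lc) m))) κ u κ' u') + cB • mfNeg ((vh₂S 3 Lc) κ u κ' u')) κ (u + (Lc : ℤ) • t) κ' (u' + (Lc : ℤ) • t)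
          = shiftK (-((Lc : ℤ) • t)) ((fun κ u κ' u' => (cE₂ * (Lc : ℝ) ^ (2 * (3 + 1))) • mmRead Lc (K3OfK
            (unitK (sfStep Lc m) (smStep 3 Lc m) (KInvStep (d := 3) Lc m)) Lc (unitS (sfStep Lc m) (smStep 3 Lc m) (Spure 3 Lc cE cVH cΛ m))
            (unitM (sfStep Lc m) (smStep 3 Lc m) (M1 3 Lc cΛ m)) (W2SymOfK (unitK (sfStep Lc m) (smStep 3 Lc m) (KInvStep (d := 3) Lc m)) Lc
            (unitS (sfStep Lc m) (smStep 3 Lc m) (Spure 3 Lc cE cVH cΛ m)) (unitM (sfStep Lc m) (smStep 3 Lc m) (M1 3 Lc cΛ m)) 0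
            (unitM₂ (sfStep Lc m) (smStep 3 Lc m) (M2Of 3 Lc (mixFFAt (toSite r) Lc) m))) κ u κ' u') + cB • mfNeg ((vh₂S 3 Lc) κ u κ' u')) κ u κ' u')) ∧
      (∀ (κ κ' α β : Fin (3 + 1)), zmode Lc (fun κ u κ' u' => (cE₂ * (Lc : ℝ) ^ (2 * (3 + 1))) • mmRead Lc (K3OfK
            (unitK (sfStep Lc m) (smStep 3 Lc m) (KInvStep (d := 3) Lc m)) Lc (unitS (sfStep Lc m) (smStep 3 Lc m) (Spure 3 Lc cE cVH cΛ m))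
            (unitM (sfStep Lc m) (smStep 3 Lc m) (M1 3 Lc cΛ m)) (W2SymOfK (unitK (sfStep Lc m) (smStep 3 Lc m) (KInvStep (d := 3) Lc m)) Lc
            (unitS (sfStep Lc m) (smStep 3 Lc m) (Spure 3 Lc cE cVH cΛ m)) (unitM (sfStep Lc m) (smStep 3 Lc m) (M1 3 Lc cΛ m)) 0
            (unitM₂ (sfStep Lc m) (smStep 3 Lc m) (M2Of 3 Lc (mixFFAt (toSite r) Lc) m))) κ u κ' u') + cB • mfNeg ((vh₂S 3 Lc) κ u κ' u')) κ κ' (Sum.inl α) (Sum.inl β) = 0)) :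
    ∃ Cw cW θW δW : ℝ, 0 ≤ θW ∧ θW < 1 ∧ 0 < δW ∧
      (∀ j, VertexFamily₂ (unitW (sfStep Lc j) (smStep 3 Lc j)
        (WbalOf 3 Lc cE cVH cΛ (T2Of 3 Lc cE cVH cΛ cE₂ cB Tc (vh₂S 3 Lc) (mixFFAt (toSite r) Lc)) (mixFFAt (toSite r) Lc) j)) Lc Cw δW) ∧
      (∀ k j, VertexFamily₂ (unitW (sfStep Lc (k + j)) (smStep 3 Lc (k + j))
          (WbalOf 3 Lc cE cVH cΛ (T2Of 3 Lc cE cVH cΛ cE₂ cB Tc (vh₂S 3 Lc) (mixFFAt (toSite r) Lc)) (mixFFAt (toSite r) Lc) (k + j)) -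
        unitW (sfStep Lc k) (smStep 3 Lc k)
          (WbalOf 3 Lc cE cVH cΛ (T2Of 3 Lc cE cVH cΛ cE₂ cB Tc (vh₂S 3 Lc) (mixFFAt (toSite r) Lc)) (mixFFAt (toSite r) Lc) k)) Lc (cW * θW ^ k) δW) := by
  have hLc : 1 ≤ Lc := le_trans (by norm_num) hLc2
  have hpin : |cE₂| ≤ (Lc : ℝ) ^ (2 * (3 + 1)) := by
    rw [hpinEq, abs_of_nonneg (by positivity)]
  obtain ⟨CM₂, δ₄, hδ₄, hmixL⟩ := hmix_an1 (d := 3) (Lc := Lc) hLc hr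
  obtain ⟨C₂, δ₂, hδ₂, hx⟩ := t2Shape_three_of_F2a_pin hLc2 hr cE cVH cΛ cE₂ cB Tc hpin hZ
  obtain ⟨c, ϑ, δT, hc, hϑ0, hϑ1, hδT, _, hCau, _⟩ := t2Drift_three_of_F2a_pinEq hLc2 hr cE cVH cΛ cE₂ cB Tc hpinEq hZ
  exact hW_hWall_three_of_T2ShapeDrift hLc2 cE cVH cΛ
    (T₂ := T2Of 3 Lc cE cVH cΛ cE₂ cB Tc (vh₂S 3 Lc) (mixFFAt (toSite r) Lc)) (δ₂ := min δ₂ δT)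
    (fun j => (hx j).mono (min_le_left _ _))
    (fun k j => ((hCau k j).mono (min_le_right _ _)))
    (lt_min hδ₂ hδT) hϑ0.le hϑ1 hmixL hδ₄ (mixFFAt_hfm (toSite r)) (mixFFAt_hm (toSite r))

end Summit.QuantumFields.BalabanUV.Beta.GAN24.WSlotT2DriftFromOneThree

end
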